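import Mathlib
import Summits.KontsevichZagierPeriods.Zeta5Search.Families.CubicalChartCoeffZ
import Summits.KontsevichZagierPeriods.Zeta5Search.Families.CellularVIMRecurrenceLaws
import Summits.KontsevichZagierPeriods.Zeta5Search.Certificates.VIMOuterSum
import HarnessLib

/-!
# ζ(5) search — fam-brown9's `M_{0,10}` leading coefficient `leading a b` IS a gap-coordinate constant term (all exponents)

HONEST FRAMING: systematic search; no irrationality claim unless certified.  Cell `pub-zeta5`, certifier 2 (cert-2 g10,
2026-08-22).  Identities between integers (binomial sums / polynomial coefficients); nothing about `ζ(5)` or `ζ(7)`; no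
number of record moves.

WHAT.  For Brown's "vanishing in the middle" plan `σ = (10,2,4,1,6,3,8,5,9,7)` with generalised exponents `a, b : Fin 10 → ℕ`
(`Cells/VanishingMiddleLeading`, fam-brown9), the census file DEFINES the leading coefficient `leading a b` as a 6-fold
terminating binomial sum read off the cubical chart of the frame `(3,8,5,9,7,10,2,4,1,6)` — the dual cell `X_σ` with the
point `6` at infinity, finite points in the order `3 < 8 < 5 < 9 < 7 < 10 < 2 < 4 < 1`, eight consecutive gaps `g₀,…,g₇`.
In these gap coordinates the integrand is `∏_e L_e(g)^{a_e} / g^{B}` with the eight finite `δ⁰`-chords as spans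
`{1,2} ↦ [6,7]`, `{2,3} ↦ [0..5]`, `{3,4} ↦ [0..6]`, `{4,5} ↦ [2..6]`, `{7,8} ↦ [1,2,3]`, `{8,9} ↦ [1,2]`, `{9,10} ↦ [3,4]`,
`{10,1} ↦ [5,6,7]` (`{5,6}`, `{6,7}` pass through `∞`) and the gap exponents `B = (b₆,b₇,b₈,b₉,b₁₀,b₁,b₂,b₃)` (1-based;
the `σ`-sides `{3,8},{8,5},…,{4,1}`).
* `vimSpanProd a`, `vimGap b`, **`vimDualCT a b = [g^{B}] vimSpanProd a`** (an `MvPolynomial (Fin 8) ℤ` coefficient — a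
  manifestly non-negative count of transport tables, as for `₈π₈^∨` in `Families/DualConstantTerm`);
* **`leading_eq_vimDualCT`**: for every BALANCED pair (`Balanced a b`, the ten vertex balances) `leading a b = vimDualCT a b`
  — constant-term invariance in the cubical chart with eight gaps (`CubicalChartN.coeff_chart`, `N = 7`), the six binomials
  `1−x₁x₂, 1−x₁x₂x₃, 1−x₂⋯x₆, 1−x₃x₄, 1−x₅x₆x₇, 1−x₆x₇` of the census formula being the chart images of the chords
  `[1,2],[1,2,3],[2..6],[3,4],[5,6,7],[6,7]` and its seven series `C(c_j + l, l)` the gaps `g₁,…,g₇`; the balances turn the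
  census file's index bookkeeping into the chart's;
* **`A_eq_vimDualCT`**: on the diagonal, `CellularVIMRecurrenceLaws.A n = vimDualCT (n,…,n) (n,…,n)` for ALL `n` (P2 g6's
  `vim_A_one_eq_dualCount` was `n = 1`, in another gauge).
Exact cross-check outside the kernel: `HOME/cert-2/g10/code/c3_vim.py` (30 random balanced pairs + the diagonal `n ≤ 3`:
`1, 61, 52921, 94357501`).  Standard axioms only.
-/

noncomputable section

open MvPowerSeries Finset

namespace Summit.KontsevichZagierPeriods.Zeta5Search.Families.Cellular

namespace CubicalChartN

open Summit.KontsevichZagierPeriods.Zeta5Search.Brown8 (coeffPow)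
open CubicalChart (coeffPow_of_idx_neg coeffPow_nat_nat coeffPow_negSucc_nat coeffPow_zero_idx)
open Summit.KontsevichZagierPeriods.Zeta5Search.Cells.VanishingMiddleLeading (Balanced binom binom_eq_choose shiftBinom
  term sumUpTo leading balanced_basic)
open Summit.KontsevichZagierPeriods.Zeta5Search.Families.CellularVIMRecurrenceLaws (A)

/-! ## The gap-coordinate data of the VIM dual cell (frame gauge, `6` at infinity) -/

/-- The numerator: the eight finite `δ⁰`-chords as spans of the gaps `g₀,…,g₇`, with exponents
`a₁ ↦ [6,7]`, `a₂ ↦ [0..5]`, `a₃ ↦ [0..6]`, `a₄ ↦ [2..6]`, `a₇ ↦ [1,2,3]`, `a₈ ↦ [1,2]`, `a₉ ↦ [3,4]`, `a₁₀ ↦ [5,6,7]`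
(0-based `a 0, a 1, a 2, a 3, a 6, a 7, a 8, a 9`; `a 4, a 5` sit on the chords through `∞`). -/
def vimSpanProd (a : Fin 10 → ℕ) : MvPolynomial (Fin 8) ℤ :=
  (MvPolynomial.X 6 + MvPolynomial.X 7) ^ a 0 *
  (MvPolynomial.X 0 + MvPolynomial.X 1 + MvPolynomial.X 2 + MvPolynomial.X 3 + MvPolynomial.X 4 + MvPolynomial.X 5) ^ a 1 *
  (MvPolynomial.X 0 + MvPolynomial.X 1 + MvPolynomial.X 2 + MvPolynomial.X 3 + MvPolynomial.X 4 + MvPolynomial.X 5 +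
    MvPolynomial.X 6) ^ a 2 *
  (MvPolynomial.X 2 + MvPolynomial.X 3 + MvPolynomial.X 4 + MvPolynomial.X 5 + MvPolynomial.X 6) ^ a 3 *
  (MvPolynomial.X 1 + MvPolynomial.X 2 + MvPolynomial.X 3) ^ a 6 *
  (MvPolynomial.X 1 + MvPolynomial.X 2) ^ a 7 *
  (MvPolynomial.X 3 + MvPolynomial.X 4) ^ a 8 *
  (MvPolynomial.X 5 + MvPolynomial.X 6 + MvPolynomial.X 7) ^ a 9

/-- The gap exponents `B = (b₆,b₇,b₈,b₉,b₁₀,b₁,b₂,b₃)` (0-based `b 5, …, b 9, b 0, b 1, b 2`) of the gaps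
`{3,8},{8,5},{5,9},{9,7},{7,10},{10,2},{2,4},{4,1}`. -/
def vimGap (b : Fin 10 → ℕ) : Fin 8 → ℕ := ![b 5, b 6, b 7, b 8, b 9, b 0, b 1, b 2]

/-- **The VIM dual constant term** `[g^{B}] vimSpanProd a` in the frame gauge. -/
def vimDualCT (a b : Fin 10 → ℕ) : ℤ :=
  MvPolynomial.coeff (Finsupp.equivFunOnFinite.symm (vimGap b)) (vimSpanProd a)

/-- `vimSpanProd a` is homogeneous of degree `a₁+a₂+a₃+a₄+a₇+a₈+a₉+a₁₀`. -/
theorem vimSpanProd_isHomogeneous (a : Fin 10 → ℕ) :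
    (vimSpanProd a).IsHomogeneous (a 0 + a 1 + a 2 + a 3 + a 6 + a 7 + a 8 + a 9) := by
  have h1 : ∀ i : Fin 8, (MvPolynomial.X i : MvPolynomial (Fin 8) ℤ).IsHomogeneous 1 :=
    fun i => MvPolynomial.isHomogeneous_X ℤ i
  unfold vimSpanProd
  have e : a 0 + a 1 + a 2 + a 3 + a 6 + a 7 + a 8 + a 9 =
      1 * a 0 + 1 * a 1 + 1 * a 2 + 1 * a 3 + 1 * a 6 + 1 * a 7 + 1 * a 8 + 1 * a 9 := by ring
  rw [e]
  refine (((((((MvPolynomial.IsHomogeneous.pow ?_ _).mul (MvPolynomial.IsHomogeneous.pow ?_ _)).mul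
    (MvPolynomial.IsHomogeneous.pow ?_ _)).mul (MvPolynomial.IsHomogeneous.pow ?_ _)).mul
    (MvPolynomial.IsHomogeneous.pow ?_ _)).mul (MvPolynomial.IsHomogeneous.pow ?_ _)).mul
    (MvPolynomial.IsHomogeneous.pow ?_ _)).mul (MvPolynomial.IsHomogeneous.pow ?_ _)
  · exact (h1 6).add (h1 7)
  · exact (((((h1 0).add (h1 1)).add (h1 2)).add (h1 3)).add (h1 4)).add (h1 5)
  · exact ((((((h1 0).add (h1 1)).add (h1 2)).add (h1 3)).add (h1 4)).add (h1 5)).add (h1 6)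
  · exact ((((h1 2).add (h1 3)).add (h1 4)).add (h1 5)).add (h1 6)
  · exact ((h1 1).add (h1 2)).add (h1 3)
  · exact (h1 1).add (h1 2)
  · exact (h1 3).add (h1 4)
  · exact ((h1 5).add (h1 6)).add (h1 7)

/-! ## The chart images (N = 7) -/

/-- The unit factors at numerals. -/
theorem unitFac_num7 : unitFac (1 : Fin 8) = 1 - x 0 ∧ unitFac (2 : Fin 8) = 1 - x 1 ∧ unitFac (3 : Fin 8) = 1 - x 2 ∧
    unitFac (4 : Fin 8) = 1 - x 3 ∧ unitFac (5 : Fin 8) = 1 - x 4 ∧ unitFac (6 : Fin 8) = 1 - x 5 ∧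
    unitFac (7 : Fin 8) = 1 - x 6 := ⟨rfl, rfl, rfl, rfl, rfl, rfl, rfl⟩

/-- The eight gaps in the chart, as explicit products. -/
theorem gChart_eq7 : gChart (0 : Fin 8) = x 0 * x 1 * x 2 * x 3 * x 4 * x 5 * x 6 ∧
    gChart (1 : Fin 8) = x 1 * x 2 * x 3 * x 4 * x 5 * x 6 * (1 - x 0) ∧
    gChart (2 : Fin 8) = x 2 * x 3 * x 4 * x 5 * x 6 * (1 - x 1) ∧
    gChart (3 : Fin 8) = x 3 * x 4 * x 5 * x 6 * (1 - x 2) ∧ gChart (4 : Fin 8) = x 4 * x 5 * x 6 * (1 - x 3) ∧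
    gChart (5 : Fin 8) = x 5 * x 6 * (1 - x 4) ∧ gChart (6 : Fin 8) = x 6 * (1 - x 5) ∧ gChart (7 : Fin 8) = 1 - x 6 := by
  obtain ⟨u1, u2, u3, u4, u5, u6, u7⟩ := unitFac_num7
  simp only [gChart, tail, monomial_symm_eq, Fin.prod_univ_seven, unitFac_zero, u1, u2, u3, u4, u5, u6, u7]
  simp

/-- The chart images of the eight chords: `[6,7] ↦ 1 − x₆x₇`, `[0..5] ↦ x₆x₇`, `[0..6] ↦ x₇`, `[2..6] ↦ x₇(1 − x₂⋯x₆)`,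
`[1,2,3] ↦ x₄x₅x₆x₇(1 − x₁x₂x₃)`, `[1,2] ↦ x₃⋯x₇(1 − x₁x₂)`, `[3,4] ↦ x₅x₆x₇(1 − x₃x₄)`, `[5,6,7] ↦ 1 − x₅x₆x₇`
(1-based `x`; Lean variables are 0-based). -/
theorem chart_vimSpans :
    chart (MvPolynomial.X 6 + MvPolynomial.X 7 : MvPolynomial (Fin 8) ℤ) = 1 - x 5 * x 6 ∧
    chart (MvPolynomial.X 0 + MvPolynomial.X 1 + MvPolynomial.X 2 + MvPolynomial.X 3 + MvPolynomial.X 4 +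
      MvPolynomial.X 5 : MvPolynomial (Fin 8) ℤ) = x 5 * x 6 ∧
    chart (MvPolynomial.X 0 + MvPolynomial.X 1 + MvPolynomial.X 2 + MvPolynomial.X 3 + MvPolynomial.X 4 +
      MvPolynomial.X 5 + MvPolynomial.X 6 : MvPolynomial (Fin 8) ℤ) = x 6 ∧
    chart (MvPolynomial.X 2 + MvPolynomial.X 3 + MvPolynomial.X 4 + MvPolynomial.X 5 + MvPolynomial.X 6 :
      MvPolynomial (Fin 8) ℤ) = x 6 * (1 - x 1 * x 2 * x 3 * x 4 * x 5) ∧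
    chart (MvPolynomial.X 1 + MvPolynomial.X 2 + MvPolynomial.X 3 : MvPolynomial (Fin 8) ℤ) =
      x 3 * x 4 * x 5 * x 6 * (1 - x 0 * x 1 * x 2) ∧
    chart (MvPolynomial.X 1 + MvPolynomial.X 2 : MvPolynomial (Fin 8) ℤ) = x 2 * x 3 * x 4 * x 5 * x 6 * (1 - x 0 * x 1) ∧
    chart (MvPolynomial.X 3 + MvPolynomial.X 4 : MvPolynomial (Fin 8) ℤ) = x 4 * x 5 * x 6 * (1 - x 2 * x 3) ∧
    chart (MvPolynomial.X 5 + MvPolynomial.X 6 + MvPolynomial.X 7 : MvPolynomial (Fin 8) ℤ) = 1 - x 4 * x 5 * x 6 := by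
  obtain ⟨g0, g1, g2, g3, g4, g5, g6, g7⟩ := gChart_eq7
  simp only [map_add, chart_X, g0, g1, g2, g3, g4, g5, g6, g7]
  refine ⟨?_, ?_, ?_, ?_, ?_, ?_, ?_, ?_⟩ <;> ring

/-- Exponent vector of `x₁x₂` (variables `0,1`). -/
def w01 : Fin 7 →₀ ℕ := Finsupp.equivFunOnFinite.symm fun k => if k.val ≤ 1 then 1 else 0
/-- Exponent vector of `x₁x₂x₃` (variables `0,1,2`). -/
def w012 : Fin 7 →₀ ℕ := Finsupp.equivFunOnFinite.symm fun k => if k.val ≤ 2 then 1 else 0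
/-- Exponent vector of `x₂⋯x₆` (variables `1,…,5`). -/
def w12345 : Fin 7 →₀ ℕ := Finsupp.equivFunOnFinite.symm fun k => if 1 ≤ k.val ∧ k.val ≤ 5 then 1 else 0
/-- Exponent vector of `x₃x₄` (variables `2,3`). -/
def w23 : Fin 7 →₀ ℕ := Finsupp.equivFunOnFinite.symm fun k => if 2 ≤ k.val ∧ k.val ≤ 3 then 1 else 0
/-- Exponent vector of `x₅x₆x₇` (variables `4,5,6`). -/
def w456 : Fin 7 →₀ ℕ := Finsupp.equivFunOnFinite.symm fun k => if 4 ≤ k.val then 1 else 0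
/-- Exponent vector of `x₆x₇` (variables `5,6`). -/
def w56 : Fin 7 →₀ ℕ := Finsupp.equivFunOnFinite.symm fun k => if 5 ≤ k.val then 1 else 0

/-- The six binomial monomials as products. -/
theorem vim_binomial_monomials : (monomial w01 (1 : ℤ) : T 7) = x 0 * x 1 ∧ (monomial w012 (1 : ℤ) : T 7) = x 0 * x 1 * x 2 ∧
    (monomial w12345 (1 : ℤ) : T 7) = x 1 * x 2 * x 3 * x 4 * x 5 ∧ (monomial w23 (1 : ℤ) : T 7) = x 2 * x 3 ∧
    (monomial w456 (1 : ℤ) : T 7) = x 4 * x 5 * x 6 ∧ (monomial w56 (1 : ℤ) : T 7) = x 5 * x 6 := by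
  simp only [w01, w012, w12345, w23, w456, w56, monomial_symm_eq, Fin.prod_univ_seven]
  simp

/-- The prefactor monomial `x^{c(a)}`, `c(a) = a₈·tail₂ + a₇·tail₃ + a₉·tail₄ + a₂·tail₅ + (a₃+a₄)·tail₆` (1-based `a`). -/
theorem monomial_cVIM (a : Fin 10 → ℕ) :
    (monomial (a 7 • tail (2 : Fin 8) + a 6 • tail (3 : Fin 8) + a 8 • tail (4 : Fin 8) + a 1 • tail (5 : Fin 8) +
      (a 2 + a 3) • tail (6 : Fin 8)) (1 : ℤ) : T 7) =
      (x 2 * x 3 * x 4 * x 5 * x 6) ^ a 7 * (x 3 * x 4 * x 5 * x 6) ^ a 6 * (x 4 * x 5 * x 6) ^ a 8 * (x 5 * x 6) ^ a 1 *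
        x 6 ^ (a 2 + a 3) := by
  rw [MvPowerSeries.monomial_one_eq, Finsupp.prod_fintype _ _ (fun i => by simp)]
  simp only [Fin.prod_univ_seven, Finsupp.coe_add, Finsupp.coe_smul, Pi.add_apply, Pi.smul_apply, tail_apply,
    smul_eq_mul]
  simp only [Fin.isValue, Fin.val_zero, Fin.val_one, Fin.val_two, show (3 : Fin 8).val = 3 from rfl,
    show (4 : Fin 8).val = 4 from rfl, show (5 : Fin 8).val = 5 from rfl, show (6 : Fin 8).val = 6 from rfl,
    show (3 : Fin 7).val = 3 from rfl, show (4 : Fin 7).val = 4 from rfl, show (5 : Fin 7).val = 5 from rfl,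
    show (6 : Fin 7).val = 6 from rfl]
  norm_num
  ring

/-- **The chart image of the VIM numerator**, binomial factors in the census file's summation order
`a₈, a₇, a₄, a₉, a₁₀, a₁`. -/
theorem chart_vimSpanProd (a : Fin 10 → ℕ) :
    chart (vimSpanProd a) = (monomial (a 7 • tail (2 : Fin 8) + a 6 • tail (3 : Fin 8) + a 8 • tail (4 : Fin 8) +
      a 1 • tail (5 : Fin 8) + (a 2 + a 3) • tail (6 : Fin 8)) 1 : T 7) *
      ((1 - monomial w01 1) ^ a 7 * ((1 - monomial w012 1) ^ a 6 * ((1 - monomial w12345 1) ^ a 3 *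
        ((1 - monomial w23 1) ^ a 8 * ((1 - monomial w456 1) ^ a 9 * (1 - monomial w56 1) ^ a 0))))) := by
  obtain ⟨s67, s05, s06, s26, s123, s12, s34, s567⟩ := chart_vimSpans
  obtain ⟨m01, m012, m12345, m23, m456, m56⟩ := vim_binomial_monomials
  unfold vimSpanProd
  rw [map_mul, map_mul, map_mul, map_mul, map_mul, map_mul, map_mul, map_pow, map_pow, map_pow, map_pow, map_pow,
    map_pow, map_pow, map_pow, s67, s05, s06, s26, s123, s12, s34, s567, monomial_cVIM, m01, m012, m12345, m23, m456, m56]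
  simp only [mul_pow]
  ring

/-! ## The census file's ingredients in chart vocabulary (`sumUpTo_eq` is `Certificates/VIMOuterSum`'s) -/

/-- `shiftBinom m l = C(m + l, l) = [y^l](1 − y)^{−m−1}`. -/
theorem shiftBinom_eq_coeffPow (m : ℕ) (l : ℤ) : shiftBinom m l = coeffPow (-(m : ℤ) - 1) l := by
  unfold shiftBinom
  by_cases hl : l < 0
  · rw [if_pos hl, coeffPow_of_idx_neg _ _ hl]
  · rw [if_neg hl]
    obtain ⟨k, rfl⟩ := Int.eq_ofNat_of_zero_le (le_of_not_gt hl)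
    rw [Int.toNat_natCast, coeffPow_negSucc_nat, binom_eq_choose]

/-- `M(β)` for eight gaps, with the sum over `Fin 8` (so that `Fin.sum_univ_eight` evaluates it). -/
theorem Mexp_apply8 (β : Fin 8 →₀ ℕ) (k : Fin 7) :
    Mexp β k = ∑ w : Fin 8, if w.val ≤ k.val then β w else 0 := Mexp_apply β k

/-! ## The theorem -/

/-- **fam-brown9's census leading coefficient IS the gap-coordinate constant term**: for every balanced exponent pair,
`leading a b = [g^{B}] vimSpanProd a`. -/
theorem leading_eq_vimDualCT (a b : Fin 10 → ℕ) (hbal : Balanced a b) : leading a b = vimDualCT a b := by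
  have hB : ∀ w : Fin 8, vimGap b w = ![b 5, b 6, b 7, b 8, b 9, b 0, b 1, b 2] w := fun w => rfl
  -- the balances, as integer identities
  obtain ⟨v1, v2, v3, v4, v5, v6, v7, v8, v9, v10⟩ := hbal
  -- homogeneity
  have hdeg : a 0 + a 1 + a 2 + a 3 + a 6 + a 7 + a 8 + a 9 = ∑ w, vimGap b w := by
    rw [Fin.sum_univ_eight]; simp only [vimGap, Matrix.cons_val]; omega
  have hct := coeff_chart (vimSpanProd a) (vimGap b) (hdeg ▸ vimSpanProd_isHomogeneous a)
  symm
  unfold vimDualCT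
  rw [← hct, ← coeffZ_natCast, chart_vimSpanProd, mul_assoc, coeffZ_monomial_mul]
  simp only [mul_assoc, coeffZ_oneSubPow_mul, coeffZ_U, Finset.mul_sum]
  -- the census side
  unfold leading
  simp only [Certificates.VIMInner.sumUpTo_eq]
  refine Finset.sum_congr rfl fun k₁ _ => Finset.sum_congr rfl fun k₂ _ => Finset.sum_congr rfl fun k₃ _ =>
    Finset.sum_congr rfl fun k₄ _ => Finset.sum_congr rfl fun k₅ _ => Finset.sum_congr rfl fun k₆ _ => ?_
  -- one term
  unfold term
  have hsign : ∀ c : ℕ, (if c % 2 = 0 then (1 : ℤ) else -1) = (-1) ^ c := fun c => by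
    rcases Nat.even_or_odd c with hc | hc
    · rw [if_pos (Nat.even_iff.mp hc), hc.neg_one_pow]
    · rw [if_neg (by rw [Nat.odd_iff.mp hc]; norm_num), hc.neg_one_pow]
  simp only [hsign, binom_eq_choose, shiftBinom_eq_coeffPow, Nat.cast_mul, coeffPow_nat_nat]
  rw [Fin.prod_univ_seven]
  simp only [Mexp_apply8, Fin.sum_univ_eight, Finsupp.coe_equivFunOnFinite_symm, Finsupp.coe_add, Finsupp.coe_smul,
    Pi.add_apply, Pi.smul_apply, smul_eq_mul, tail_apply, w01, w012, w12345, w23, w456, w56, vimGap, Fin.isValue,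
    Matrix.cons_val_zero, Matrix.cons_val_one, Matrix.cons_val]
  simp only [Fin.val_zero, Fin.val_one, Fin.val_two, show (3 : Fin 8).val = 3 from rfl,
    show (4 : Fin 8).val = 4 from rfl, show (5 : Fin 8).val = 5 from rfl, show (6 : Fin 8).val = 6 from rfl,
    show (7 : Fin 8).val = 7 from rfl, show (3 : Fin 7).val = 3 from rfl, show (4 : Fin 7).val = 4 from rfl,
    show (5 : Fin 7).val = 5 from rfl, show (6 : Fin 7).val = 6 from rfl, Fin.succ_zero_eq_one, Fin.succ_one_eq_two,
    show (2 : Fin 7).succ = 3 from rfl, show (3 : Fin 7).succ = 4 from rfl, show (4 : Fin 7).succ = 5 from rfl,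
    show (5 : Fin 7).succ = 6 from rfl, show (6 : Fin 7).succ = 7 from rfl, Matrix.cons_val]
  norm_num
  -- the balances rewrite the census indices into the chart's
  have e5 : (b 5 : ℤ) = a 6 + a 7 - b 6 := by omega
  have e8 : (b 8 : ℤ) = a 7 + a 8 - b 7 := by omega
  have e0 : (b 0 : ℤ) = a 8 + a 9 - b 9 := by omega
  have e1 : (b 1 : ℤ) = a 2 + a 3 - b 2 := by omega
  have e3 : (b 3 : ℤ) = a 9 + a 0 - b 2 := by omega
  have ea : (a 8 : ℤ) = a 0 + a 1 - a 7 := by omega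
  rw [e5, e8, e0, e1, e3, ea]
  ring_nf

/-- **On the diagonal**: `CellularVIMRecurrenceLaws.A n = vimDualCT (n,…,n) (n,…,n)` for every `n`. -/
theorem A_eq_vimDualCT (n : ℕ) : A n = vimDualCT (Cells.VanishingMiddleLeading.basic n) (Cells.VanishingMiddleLeading.basic n) :=
  leading_eq_vimDualCT _ _ (balanced_basic n)

end CubicalChartN

end Summit.KontsevichZagierPeriods.Zeta5Search.Families.Cellular
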